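import Mathlib.AlgebraicGeometry.EllipticCurve.ModelsWithJ
import Mathlib.AlgebraicGeometry.EllipticCurve.NormalForms
import Mathlib.FieldTheory.IsAlgClosed.Basic
import Literature.NumberTheory.EllipticCurves.VariableChangePointsMap
import HarnessLib

/-!
# The curve `y² + xy = x³ - 36x/(j - 1728) - 1/(j - 1728)` and the `x`-rational isomorphism
# between two curves with the same `j`-invariant

Topic `NumberTheory/EllipticCurves`. Two elementary facts from Silverman, *AEC*, III.§1:

* `Literature.NumberTheory.EllipticCurves.tateFormOfJ j` (**definition**): for `j ≠ 0, 1728`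
  in a field `F`, the Weierstrass equation `y² + xy = x³ - 36x/(j - 1728) - 1/(j - 1728)`,
  an elliptic curve with `j`-invariant `j` (Silverman, *AEC*, proof of Prop. III.1.4(c),
  PDF p. 52: "`E : y² + xy = x³ - 36x/(j₀ - 1728) - 1/(j₀ - 1728)` … `j(E) = j₀`"). It is
  Mathlib's denominator-free `WeierstrassCurve.ofJNe0Or1728 j`
  (`y² + (j - 1728)xy = x³ - 36(j - 1728)³x - (j - 1728)⁵`) rescaled by `u = j - 1728`
  (`tateFormOfJ_eq_smul_ofJNe0Or1728`), whence `tateFormOfJ_j` and `isElliptic_tateFormOfJ`.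
  Its interest is arithmetic: `a₁ = 1`, `a₂ = a₃ = 0`, `a₄ = 36a₆`, `a₆ = -1/(j - 1728)`, so
  at a place `v` with `|j|_v > 1` it is integral and reduces to the split node `y² + xy = x³`
  ("Tate form", the shape of the Tate curve `E_q`; file `TateFormLevels`).
* `Literature.NumberTheory.EllipticCurves.exists_addEquiv_baseChange_x_affine_of_j_eq`
  (**theorem**): two elliptic curves `E, E'` over a field `F` of characteristic `0` with
  `j(E) = j(E') ∉ {0, 1728}` become isomorphic over an algebraically closed extension `L`
  (Silverman, *AEC*, Prop. III.1.4(b); Mathlib `WeierstrassCurve.exists_variableChange_of_j_eq`),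
  and more precisely (*AEC* X.5.4 with Cor. X.5.4.1: for `j ≠ 0, 1728` the twists are
  quadratic, the isomorphism is `(x, y) ↦ (x, √d·y)` between short models) the isomorphism
  `E(L) ≃+ E'(L)` may be chosen so that **the `x`-coordinate of the image of `(x, y)` is
  `αx + β` with `α, β ∈ F`**. Proof: short normal forms `C₁ • E`, `C₂ • E'` over `F`
  (Mathlib `exists_variableChange_isShortNF`), then the scaling `⟨u, 0, 0, 0⟩` with
  `u² = d := (a₆/a₆')/(a₄/a₄') ∈ F` (so `u⁴ = a₄/a₄'`, `u⁶ = a₆/a₆'`, exactly as in Mathlib's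
  proof of `exists_variableChange_of_j_eq`), composed from the tree's point isomorphisms
  `VariableChange.pointEquivBaseChange` / `pointEquiv`; the new `x`-coordinate is
  `u₂²·d⁻¹·u₁⁻²(x - r₁) + r₂`.

Consequence used downstream (`PotentiallyMultiplicativeRamifiedTorsion`): if `σ ∈ Aut(L/F)`
fixes a point `P ∈ E(L)` then it fixes the `x`-coordinate of the image of `P` in `E'(L)`; for
`E' = tateFormOfJ j` this puts the abscissae of the `ℓ`-torsion of `E'` in the field fixed by
the inertia group as soon as the `ℓ`-torsion of `E` is unramified.

`lean search` (2026-08-14): Mathlib has `ofJNe0Or1728`, `ofJ`, `exists_variableChange_of_j_eq`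
(existence only, over a separably closed field); the tree has no model with `a₁ = 1` of given
`j` and no `x`-rationality statement.

## References

* [SilvermanAEC2009] J. H. Silverman, *The Arithmetic of Elliptic Curves*, 2nd ed., GTM 106,
  Springer 2009: Prop. III.1.4(b),(c) and proof (PDF pp. 51–52), III.1 Table 3.1, X.5
  Prop. 5.4 and Cor. 5.4.1 (quadratic twists for `j ≠ 0, 1728`).
* [SilvermanATAEC1994] J. H. Silverman, *Advanced Topics in the Arithmetic of Elliptic Curves*,
  GTM 151, Springer 1994, V.3 Thm. 3.1 and V.5 Lemma 5.1 (the curve `y² + xy = x³ - 36x/(j-1728)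
  - 1/(j-1728)` and the Tate curve).
-/

noncomputable section

namespace Literature.NumberTheory.EllipticCurves

open WeierstrassCurve

universe u v

variable {F : Type u} [Field F]

/-! ## The Tate form of invariant `j` -/

/-- **The curve `y² + xy = x³ - 36x/(j - 1728) - 1/(j - 1728)`** of `j`-invariant `j`
(for `j ≠ 0, 1728`). Silverman, *AEC*, proof of Prop. III.1.4(c) (PDF p. 52); it is
`ofJNe0Or1728 j` rescaled by `u = j - 1728`. [cite: SilvermanAEC2009, Prop. III.1.4(c) (proof)] -/
def tateFormOfJ (j : F) : WeierstrassCurve F :=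
  ⟨1, 0, 0, -36 / (j - 1728), -1 / (j - 1728)⟩

section TateFormOfJ

variable (j : F)

/-- `a₁ = 1` (by definition). [folklore] -/
@[simp] theorem tateFormOfJ_a₁ : (tateFormOfJ j).a₁ = 1 := rfl

/-- `a₂ = 0` (by definition). [folklore] -/
@[simp] theorem tateFormOfJ_a₂ : (tateFormOfJ j).a₂ = 0 := rfl

/-- `a₃ = 0` (by definition). [folklore] -/
@[simp] theorem tateFormOfJ_a₃ : (tateFormOfJ j).a₃ = 0 := rfl

/-- `a₄ = -36/(j - 1728)` (by definition). [folklore] -/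
@[simp] theorem tateFormOfJ_a₄ : (tateFormOfJ j).a₄ = -36 / (j - 1728) := rfl

/-- `a₆ = -1/(j - 1728)` (by definition). [folklore] -/
@[simp] theorem tateFormOfJ_a₆ : (tateFormOfJ j).a₆ = -1 / (j - 1728) := rfl

/-- `a₄ = 36 a₆`. [folklore] -/
theorem tateFormOfJ_a₄_eq_mul_a₆ : (tateFormOfJ j).a₄ = 36 * (tateFormOfJ j).a₆ := by
  simp only [tateFormOfJ_a₄, tateFormOfJ_a₆]
  ring

variable {j}

/-- `tateFormOfJ j` is Mathlib's `ofJNe0Or1728 j` (`y² + (j - 1728)xy = x³ - 36(j - 1728)³x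
- (j - 1728)⁵`) rescaled by `u = j - 1728`. [folklore] -/
theorem tateFormOfJ_eq_smul_ofJNe0Or1728 (h : j ≠ 1728) :
    tateFormOfJ j =
      (⟨Units.mk0 (j - 1728) (sub_ne_zero.mpr h), 0, 0, 0⟩ : VariableChange F) •
        ofJNe0Or1728 j := by
  have h' : j - 1728 ≠ 0 := sub_ne_zero.mpr h
  ext
  · simp only [tateFormOfJ_a₁, variableChange_a₁, ofJNe0Or1728, Units.val_inv_eq_inv_val,
      Units.val_mk0]
    field_simp
    ring
  · simp [tateFormOfJ_a₂, variableChange_a₂, ofJNe0Or1728]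
  · simp [tateFormOfJ_a₃, variableChange_a₃, ofJNe0Or1728]
  · simp only [tateFormOfJ_a₄, variableChange_a₄, ofJNe0Or1728, Units.val_inv_eq_inv_val,
      Units.val_mk0]
    field_simp
    ring
  · simp only [tateFormOfJ_a₆, variableChange_a₆, ofJNe0Or1728, Units.val_inv_eq_inv_val,
      Units.val_mk0]
    field_simp
    ring

/-- `tateFormOfJ j` is an elliptic curve for `j ≠ 0, 1728` (`Δ = j²/(j - 1728)³`).
Silverman, *AEC*, proof of Prop. III.1.4(c). [cite: SilvermanAEC2009, Prop. III.1.4(c) (proof)] -/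
theorem isElliptic_tateFormOfJ (h0 : j ≠ 0) (h1728 : j ≠ 1728) : (tateFormOfJ j).IsElliptic := by
  haveI : Fact (IsUnit j) := ⟨isUnit_iff_ne_zero.mpr h0⟩
  haveI : Fact (IsUnit (j - 1728)) := ⟨isUnit_iff_ne_zero.mpr (sub_ne_zero.mpr h1728)⟩
  rw [tateFormOfJ_eq_smul_ofJNe0Or1728 h1728]
  infer_instance

/-- **`j(tateFormOfJ j) = j`** for `j ≠ 0, 1728` (the `j`-invariant taken with respect to the
elliptic-curve structure `isElliptic_tateFormOfJ`). Silverman, *AEC*, proof of Prop. III.1.4(c).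
[cite: SilvermanAEC2009, Prop. III.1.4(c) (proof)] -/
theorem tateFormOfJ_j (h0 : j ≠ 0) (h1728 : j ≠ 1728) :
    haveI := isElliptic_tateFormOfJ h0 h1728
    (tateFormOfJ j).j = j := by
  haveI : Fact (IsUnit j) := ⟨isUnit_iff_ne_zero.mpr h0⟩
  haveI : Fact (IsUnit (j - 1728)) := ⟨isUnit_iff_ne_zero.mpr (sub_ne_zero.mpr h1728)⟩
  have key : ∀ (W : WeierstrassCurve F) (hW : W = (⟨Units.mk0 (j - 1728)
      (sub_ne_zero.mpr h1728), 0, 0, 0⟩ : VariableChange F) • ofJNe0Or1728 j)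
      [W.IsElliptic], W.j = j := by
    intro W hW _
    subst hW
    rw [variableChange_j, ofJNe0Or1728_j]
  haveI := isElliptic_tateFormOfJ h0 h1728
  exact key _ (tateFormOfJ_eq_smul_ofJNe0Or1728 h1728)

end TateFormOfJ

/-! ## Short normal forms with the same `j`-invariant -/

section ShortNF

variable {E E' : WeierstrassCurve F}

/-- For an elliptic curve in short normal form `y² = x³ + a₄x + a₆`: `j ≠ 0 ⟹ a₄ ≠ 0`
(`j = 6912a₄³/(4a₄³ + 27a₆²)`). Silverman, *AEC*, III.§1. [folklore] -/
theorem a₄_ne_zero_of_isShortNF [E.IsElliptic] [E.IsShortNF] (h0 : E.j ≠ 0) : E.a₄ ≠ 0 := by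
  intro h
  apply h0
  rw [j_of_isShortNF, h]
  simp

/-- For an elliptic curve in short normal form `y² = x³ + a₄x + a₆` over a field with `2 ≠ 0`:
`j ≠ 1728 ⟹ a₆ ≠ 0` (`j - 1728 = -1728·27a₆²/(4a₄³ + 27a₆²)`). Silverman, *AEC*, III.§1.
[folklore] -/
theorem a₆_ne_zero_of_isShortNF [CharZero F] [E.IsElliptic] [E.IsShortNF]
    (h1728 : E.j ≠ 1728) : E.a₆ ≠ 0 := by
  intro h
  apply h1728
  have hΔ := E.Δ'.ne_zero
  rw [coe_Δ', Δ_of_isShortNF, h] at hΔ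
  have ha₄ : E.a₄ ≠ 0 := by
    intro h0
    apply hΔ
    rw [h0]
    ring
  rw [j_of_isShortNF, h]
  have h4 : (4 : F) * E.a₄ ^ 3 + 27 * 0 ^ 2 ≠ 0 := by
    rw [zero_pow two_ne_zero, mul_zero, add_zero]
    exact mul_ne_zero (by norm_num) (pow_ne_zero 3 ha₄)
  rw [div_eq_iff h4]
  ring

/-- Two elliptic curves in short normal form with the same `j`-invariant satisfy
`a₄³a₆'² = a₄'³a₆²` (Mathlib, proof of `exists_variableChange_of_j_eq`). [folklore] -/
theorem a₄_pow_mul_a₆_sq_eq_of_j_eq [CharZero F] [E.IsElliptic] [E.IsShortNF] [E'.IsElliptic]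
    [E'.IsShortNF] (heq : E.j = E'.j) : E.a₄ ^ 3 * E'.a₆ ^ 2 = E'.a₄ ^ 3 * E.a₆ ^ 2 := by
  haveI : NeZero (2 : F) := ⟨two_ne_zero⟩
  haveI : NeZero (3 : F) := ⟨by norm_num⟩
  haveI : NeZero (4 : F) := ⟨by norm_num⟩
  haveI : NeZero (6 : F) := ⟨by norm_num⟩
  simp_rw [j, Units.val_inv_eq_inv_val, inv_mul_eq_div,
    div_eq_div_iff E.Δ'.ne_zero E'.Δ'.ne_zero, coe_Δ', Δ_of_isShortNF, c₄_of_isShortNF] at heq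
  have h47 : (47775744 : F) ≠ 0 := by norm_num
  rw [← mul_right_inj' h47]
  linear_combination heq

end ShortNF

/-! ## The `x`-rational isomorphism between curves with the same `j ≠ 0, 1728` -/

section Iso

variable [CharZero F] (E E' : WeierstrassCurve F) [E.IsElliptic] [E'.IsElliptic]
  (L : Type v) [Field L] [Algebra F L] [IsAlgClosed L] [DecidableEq L]

/-- **Isomorphism over `L = L̄` of two curves over `F` with the same `j ≠ 0, 1728`, with
`F`-affine `x`-coordinate.** Let `E, E'` be elliptic curves over a field `F` of characteristic
`0` with `j(E) = j(E') ∉ {0, 1728}` and `L ⊇ F` algebraically closed. Then there are an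
isomorphism of groups `e : E(L) ≃+ E'(L)` and `α, β ∈ F` such that `e` maps every affine point
`(x, y)` to an affine point with abscissa `αx + β`. (Silverman, *AEC*, Prop. III.1.4(b): same
`j` ⟹ isomorphic over `K̄`; for `j ≠ 0, 1728` the isomorphism between short models is
`(x, y) ↦ (u⁻²x, u⁻³y)` with `u² ∈ F` — the quadratic twist, *AEC* X.5.4 / Cor. X.5.4.1 —
composed with changes of variables defined over `F`.)
[cite: SilvermanAEC2009, Prop. III.1.4(b) and X.5 Cor. 5.4.1] -/
theorem exists_addEquiv_baseChange_x_affine_of_j_eq (heq : E.j = E'.j) (h0 : E.j ≠ 0)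
    (h1728 : E.j ≠ 1728) :
    ∃ (e : (E.baseChange L).toAffine.Point ≃+ (E'.baseChange L).toAffine.Point) (α β : F),
      ∀ (x y : L) (h : (E.baseChange L).toAffine.Nonsingular x y),
        ∃ (x' y' : L) (h' : (E'.baseChange L).toAffine.Nonsingular x' y'),
          e (.some x y h) = .some x' y' h' ∧ x' = algebraMap F L α * x + algebraMap F L β := by
  letI : Invertible (2 : F) := invertibleOfNonzero two_ne_zero
  letI : Invertible (3 : F) := invertibleOfNonzero (by norm_num)
  obtain ⟨C₁, hC₁⟩ := E.exists_variableChange_isShortNF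
  obtain ⟨C₂, hC₂⟩ := E'.exists_variableChange_isShortNF
  have hj₁ : (C₁ • E).j = (C₂ • E').j := by rw [variableChange_j, variableChange_j, heq]
  have h0₁ : (C₁ • E).j ≠ 0 := by rwa [variableChange_j]
  have h1728₁ : (C₁ • E).j ≠ 1728 := by rwa [variableChange_j]
  set E₁ := C₁ • E with hE₁
  set E₂ := C₂ • E' with hE₂
  have h0₂ : E₂.j ≠ 0 := hj₁ ▸ h0₁
  have h1728₂ : E₂.j ≠ 1728 := hj₁ ▸ h1728₁
  have ha₄ : E₁.a₄ ≠ 0 := a₄_ne_zero_of_isShortNF h0₁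
  have ha₆ : E₁.a₆ ≠ 0 := a₆_ne_zero_of_isShortNF h1728₁
  have ha₄' : E₂.a₄ ≠ 0 := a₄_ne_zero_of_isShortNF h0₂
  have ha₆' : E₂.a₆ ≠ 0 := a₆_ne_zero_of_isShortNF h1728₂
  have hrel := a₄_pow_mul_a₆_sq_eq_of_j_eq hj₁
  -- the twisting parameter `d = (a₆/a₆')/(a₄/a₄') ∈ F` and its square root `u ∈ L`
  set d : F := E₁.a₆ / E₂.a₆ / (E₁.a₄ / E₂.a₄) with hd
  have hd0 : d ≠ 0 := by
    simp only [hd]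
    exact div_ne_zero (div_ne_zero ha₆ ha₆') (div_ne_zero ha₄ ha₄')
  obtain ⟨u, hu⟩ := IsAlgClosed.exists_pow_nat_eq (algebraMap F L d) two_pos
  have hu0 : u ≠ 0 := by
    rintro rfl
    rw [zero_pow two_ne_zero, eq_comm, map_eq_zero] at hu
    exact hd0 hu
  set f := algebraMap F L with hf
  have hu4 : u ^ 4 = f E₁.a₄ / f E₂.a₄ := by
    rw [pow_mul u 2 2, hu, hd]
    simp only [map_div₀]
    have : f E₂.a₄ ≠ 0 := (map_ne_zero f).mpr ha₄'
    have : f E₂.a₆ ≠ 0 := (map_ne_zero f).mpr ha₆'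
    have : f E₁.a₄ ≠ 0 := (map_ne_zero f).mpr ha₄
    field_simp
    have := congrArg f hrel
    simp only [map_mul, map_pow] at this
    linear_combination -this
  have hu6 : u ^ 6 = f E₁.a₆ / f E₂.a₆ := by
    rw [show u ^ 6 = u ^ 4 * u ^ 2 by ring, hu4, hu, hd]
    simp only [map_div₀]
    have : f E₂.a₄ ≠ 0 := (map_ne_zero f).mpr ha₄'
    have : f E₂.a₆ ≠ 0 := (map_ne_zero f).mpr ha₆'
    have : f E₁.a₄ ≠ 0 := (map_ne_zero f).mpr ha₄
    field_simp
  -- the scaling `D = ⟨u, 0, 0, 0⟩` carries `(E₁)_L` to `(E₂)_L`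
  set D : VariableChange L := ⟨Units.mk0 u hu0, 0, 0, 0⟩ with hD
  have hDE : D • E₁.baseChange L = E₂.baseChange L := by
    haveI : (E₁.baseChange L).IsShortNF := by
      simp only [WeierstrassCurve.baseChange]
      constructor <;> simp [a₂_of_isShortNF]
    haveI : (E₂.baseChange L).IsShortNF := by
      simp only [WeierstrassCurve.baseChange]
      constructor <;> simp [a₂_of_isShortNF]
    ext
    · simp [variableChange_a₁, hD]
    · simp [variableChange_a₂, a₂_of_isShortNF, hD]
    · simp [variableChange_a₃, hD]
    · simp only [variableChange_a₄, a₁_of_isShortNF, a₂_of_isShortNF, a₃_of_isShortNF, hD,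
        Units.val_inv_eq_inv_val, Units.val_mk0, mul_zero, sub_zero, add_zero]
      rw [show (E₁.baseChange L).a₄ = f E₁.a₄ from rfl,
        show (E₂.baseChange L).a₄ = f E₂.a₄ from rfl, inv_pow, hu4]
      have : f E₁.a₄ ≠ 0 := (map_ne_zero f).mpr ha₄
      field_simp
      ring
    · simp only [variableChange_a₆, a₁_of_isShortNF, a₂_of_isShortNF, a₃_of_isShortNF, hD,
        Units.val_inv_eq_inv_val, Units.val_mk0, mul_zero, sub_zero, add_zero]
      rw [show (E₁.baseChange L).a₆ = f E₁.a₆ from rfl,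
        show (E₂.baseChange L).a₆ = f E₂.a₆ from rfl, inv_pow, hu6]
      have : f E₁.a₆ ≠ 0 := (map_ne_zero f).mpr ha₆
      field_simp
      ring
  -- the composite isomorphism
  set e₁ := VariableChange.pointEquivBaseChange E C₁ L with he₁
  set e₂ := VariableChange.pointEquiv (E₁.baseChange L) D with he₂
  set e₃ := Affine.Point.congrEquiv hDE with he₃
  set e₄ := VariableChange.pointEquivBaseChange E' C₂ L with he₄
  refine ⟨e₁.trans (e₂.trans (e₃.trans e₄.symm)), (C₂.u : F) ^ 2 * (d⁻¹ * (↑C₁.u⁻¹) ^ 2),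
    C₂.r - (C₂.u : F) ^ 2 * (d⁻¹ * (↑C₁.u⁻¹) ^ 2) * C₁.r, fun x y h => ?_⟩
  -- step 1: `(x, y) ↦ (x₁, y₁)` on `(C₁ • E)_L`
  set x₁ := (C₁.map f).toX x with hx₁
  set y₁ := (C₁.map f).toY x y with hy₁
  have h₁ : (E₁.baseChange L).toAffine.Nonsingular x₁ y₁ :=
    (VariableChange.baseChange_smul_eq E C₁ L) ▸
      (VariableChange.nonsingular_iff (E.baseChange L) (C₁.map f) x y).mpr h
  have step₁ : e₁ (.some x y h) = .some x₁ y₁ h₁ := VariableChange.pointEquivBaseChange_some E C₁ L h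
  -- step 2: the scaling `D`
  have h₂ : (D • E₁.baseChange L).toAffine.Nonsingular (D.toX x₁) (D.toY x₁ y₁) :=
    (VariableChange.nonsingular_iff _ D x₁ y₁).mpr h₁
  have step₂ : e₂ (.some x₁ y₁ h₁) = .some (D.toX x₁) (D.toY x₁ y₁) h₂ :=
    VariableChange.pointEquiv_some _ D h₁
  -- step 3: transport along `D • (E₁)_L = (E₂)_L`
  have h₃ : (E₂.baseChange L).toAffine.Nonsingular (D.toX x₁) (D.toY x₁ y₁) := hDE ▸ h₂
  have step₃ : e₃ (.some _ _ h₂) = .some (D.toX x₁) (D.toY x₁ y₁) h₃ :=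
    Affine.Point.congrEquiv_some hDE h₂
  -- step 4: back to `E'_L` by the inverse substitution of `C₂`
  set x₂ := D.toX x₁ with hx₂
  set y₂ := D.toY x₁ y₁ with hy₂
  have h₄ : (E'.baseChange L).toAffine.Nonsingular ((C₂.map f).ofX x₂) ((C₂.map f).ofY x₂ y₂) := by
    have := (VariableChange.nonsingular_ofXY_iff (E'.baseChange L) (C₂.map f) x₂ y₂).mpr
    rw [← VariableChange.baseChange_smul_eq E' C₂ L] at this
    exact this h₃
  have step₄ : e₄.symm (.some x₂ y₂ h₃) = .some ((C₂.map f).ofX x₂) ((C₂.map f).ofY x₂ y₂) h₄ := by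
    rw [AddEquiv.symm_apply_eq, he₄, VariableChange.pointEquivBaseChange_some]
    congr 1
    · exact (VariableChange.toX_ofX _ _).symm
    · exact (VariableChange.toY_ofY _ _ _).symm
  refine ⟨(C₂.map f).ofX x₂, (C₂.map f).ofY x₂ y₂, h₄, ?_, ?_⟩
  · rw [AddEquiv.trans_apply, AddEquiv.trans_apply, AddEquiv.trans_apply, step₁, step₂, step₃,
      step₄]
  · -- the new abscissa is `u₂² · u⁻² · u₁⁻² (x - r₁) + r₂` with `u⁻² = d⁻¹ ∈ F`
    have hu2 : (u⁻¹) ^ 2 = f d⁻¹ := by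
      rw [inv_pow, hu, map_inv₀]
    simp only [hx₂, hx₁, VariableChange.ofX_def, VariableChange.toX_def, VariableChange.map, hD,
      Units.coe_map, MonoidHom.coe_coe, Units.val_inv_eq_inv_val,
      Units.val_mk0, sub_zero, map_mul, map_sub, map_pow, map_inv₀, hu2]
    ring

end Iso


end Literature.NumberTheory.EllipticCurves

end
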